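import Literature.Computability.QuantumComplexity.Factoring
import Literature.Computability.QuantumComplexity.AKSMachine
import Literature.Computability.Complexity.LengthCompare
import HarnessLib

/-!
# `PRIMES ∈ P` (pqc.S05, Agrawal–Kayal–Saxena 2004): discharge of `PRIMES_mem_P`

Sibling proof file (D-0014 append protocol; theorems only) of
`Literature/Computability/QuantumComplexity/Factoring.lean`, discharging the named fact
`Literature.Computability.QuantumComplexity.PRIMES_mem_P : PRIMES ∈ P` announced there and in
`AKSMachine.lean` under this file name. Nothing new is constructed: the assembly puts together

* the mathematics of [AKS04, Thm 4.1] —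
  `AKS.aksDecide_eq_true_iff : aksDecide n = true ↔ n.Prime`
  (`Literature/NumberTheory/Primality/AKSAlgorithm.lean`, with `AKSIntrospective.lean`,
  `AKSExistsR.lean`, `AKSTheorem.lean`);
* the machine of [AKS04, §4 and Thm 5.1] — the string function `AKSMachine.aksFn` with
  `aksFn_mem_FP` (polynomial time on Mathlib's `TM2` model, through the tree's `FP` algebra),
  `aksFn_encodeNat : aksFn (encodeNat n) = [aksDecide n]` and `aksFn_of_ne` (answer `0` off the
  canonical numerals) (`AKSMachine.lean`, on top of `AKSMachineSteps/Pow/Arith.lean`);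
* the bridge "a language whose indicator is in `FP` is in `P`", `mem_P_of_mem_FP`
  (`Complexity/LengthCompare.lean`; Arora–Barak 2009, Def. 1.13).

`PRIMES = encodingNatBool.toLanguage {p | p.Prime}` (binary numerals; non-codewords lie outside the
language, and `aksFn` rejects them).

## References

* M. Agrawal, N. Kayal, N. Saxena, *PRIMES is in P*, Ann. of Math. 160 (2004) 781–793, §4 (the
  algorithm), Thm 4.1 (correctness), Thm 5.1 (polynomial running time) [AgrawalKayalSaxena2004].
* S. Arora, B. Barak, *Computational Complexity: A Modern Approach*, CUP 2009, Def. 1.13 (`P`),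
  §1.2 (decision problems as languages) [AroraBarakCC2009].
-/

noncomputable section

namespace Literature.Computability.QuantumComplexity

open _root_.Computability Complexity Complexity.Classes
open Literature.NumberTheory.Primality AKSMachine

/-- **On a canonical numeral of a non-prime the AKS machine answers `0`.**
[cite: AgrawalKayalSaxena2004, Thm 4.1] -/
theorem aksFn_encodeNat_of_not_prime {n : ℕ} (hn : ¬ n.Prime) :
    aksFn (encodeNat n) = [false] := by
  rw [aksFn_encodeNat]
  have h : AKS.aksDecide n ≠ true := fun h => hn ((AKS.aksDecide_eq_true_iff n).1 h)
  simp [Bool.eq_false_iff.2 h]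

/-- **The AKS machine decides `PRIMES`**: for every string `w`, `aksFn w = [true]` if `w ∈ PRIMES`
and `aksFn w = [false]` otherwise (strings that are not canonical numerals are rejected by
`aksFn_of_ne`; a canonical numeral `encodeNat n` is accepted iff `n` is prime, Thm 4.1).
[cite: AgrawalKayalSaxena2004, §4 and Thm 4.1] -/
theorem aksFn_decides_PRIMES (w : List Bool) :
    (w ∈ PRIMES → aksFn w = [true]) ∧ (w ∉ PRIMES → aksFn w = [false]) := by
  constructor
  · intro hw
    have hw' : w ∈ encodingNatBool.encode '' {p : ℕ | p.Prime} := hw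
    obtain ⟨p, hp, rfl⟩ := hw'
    show aksFn (encodeNat p) = [true]
    rw [aksFn_encodeNat, (AKS.aksDecide_eq_true_iff p).2 hp]
  · intro hw
    by_cases hc : encodeNat (bitsToNat w) = w
    · rw [← hc]
      refine aksFn_encodeNat_of_not_prime fun hp => hw ?_
      rw [← hc]
      exact (encode_mem_PRIMES_iff _).2 hp
    · exact aksFn_of_ne hc

/-- **Discharge of `PRIMES_mem_P`** (pqc.S05; Agrawal–Kayal–Saxena 2004, Thm 4.1 with Thm 5.1):
primality of a number given in binary is decidable in deterministic polynomial time on Mathlib's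
`TM2` model — the `FP` string function `aksFn` is the indicator of `PRIMES`
(`aksFn_decides_PRIMES`), so `mem_P_of_mem_FP` applies.
[cite: AgrawalKayalSaxena2004, Thm 4.1 and Thm 5.1] [cite: AroraBarakCC2009, Def. 1.13] -/
theorem PRIMES_mem_P_holds : PRIMES_mem_P :=
  mem_P_of_mem_FP aksFn_mem_FP PRIMES aksFn_decides_PRIMES

/-- `PRIMES ∈ P`, membership form of the discharged fact (for `simp`/term use).
[cite: AgrawalKayalSaxena2004, Thm 4.1 and Thm 5.1] -/
theorem PRIMES_mem_P' : PRIMES ∈ P :=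
  PRIMES_mem_P_holds

end Literature.Computability.QuantumComplexity

end
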